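import Summits.BirchSwinnertonDyer.BirchSwinnertonDyer.Theses.ErratumRoadFive
import Summits.BirchSwinnertonDyer.BirchSwinnertonDyer.Theorems.ErratumRoadFiveTwoVariableControl
import Summits.BirchSwinnertonDyer.BirchSwinnertonDyer.Theorems.ErratumRoadFiveIrrKNoFixedTorsion
import Literature.NumberTheory.EllipticCurves.IwasawaCyclotomicProofs
import HarnessLib

/-!
# Crux `ErratumThm23SigmaLe` (stmt-BirchSwinnertonDyer-25505, F4♯) from the two-variable core (S1) and the
# anomalous corner alone — the composition of the v3 line `erratum_chain` as a THEOREM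
# (helper, `--supports stmt-BirchSwinnertonDyer-25505`)

Cell `bsd-stepL`, seat `bsd-stepL-imc-p1` (prover g21, 2026-08-28). Theorems only (no definition, no named
fact, no `sorry`, no instance, no notation). Ninth file of the `complete` cut of crux 25505: with the
two-variable CONTROL ([JSW17, §3.4 + Lemma 3.4.1]) a kernel theorem in the exact case
(`ControlAt.exists_controlMap`, `module_finite_XBig_iterate`, p627206), its (irr_K) input a kernel theorem
(`IrrK.noFixedTorsion_of_isResiduallyIrreducible'`, p629357), and the descent algebra of [JSW17, Cor. 3.4.2]
landed (`AtData.map_charIdeal_le_span_of_twoVariable_of_control`, p611089), the crux F4♯ follows — BY NAME —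
from exactly TWO statements:

* `hFW` = the registered stub `stub_FW21_twoVarSigmaLePinned` of `Cruxes/ErratumThm23SigmaLe/Lines/erratum_chain.lean`
  VERBATIM (the OPEN two-variable core: [FW21, Thm. 4.41] Σ-imprimitive + App. B Cor. 7.21 ∕ L. 7.22 +
  the weight-`k` [CGS25, Prop. 2.4.5]-type restriction, pinned on `T_c = 0`);
* `hC` = the corner `¬(dec)` (a non-zero `Γ_{K_𝔭̄}`-fixed `p`-power-torsion element of `A_g`, i.e.
  `H⁰(K_𝔭̄, A_g[ϖ]) ≠ 0`): F4♯'s binders + `¬(dec)` → F4♯'s conclusion — the proposed v3 stub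
  `stub_cornerLocalTorsion` VERBATIM (it replaces v1/v2's `stub_cornerNoHT`, whose (HT) case split is not
  consumable for the tree's untwisted `A_g`; memo `CONTROL-25505-imc-p1-g21.md`, evidence #8 on 25505).

`erratumThm23SigmaLe_of_twoVarCore_of_corner hFW hC : Theses.ErratumRoadFive.ErratumThm23SigmaLe`: case split
on (dec); in the (dec) case (glob) comes from `IsResiduallyIrreducible Δ` (`IrrK…'`), (unr) from
`cofreeRepOver_localMap_inr_apply_eq_self`, the one-variable finite generation from
`SkinnerUrban2014.moduleFinite_XBig_newform`, the two-variable one and the EXACT control map from `ControlAt`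
(packaged with `Exists.choose`: re-packing the `letI`-typed ∃-package with `obtain` at newform data does not
elaborate), a cyclotomic `κ'` from `exists_cyclotomicZpExtension_holds`, and the descent step of
`AtData.map_charIdeal_le_span_of_twoVariable_of_control` (p611089 §1: torsion transfer
`exists_constantCoeff_ne_zero_of_control`, `charIdeal_le_map_constantCoeff_of_control`, transport) is RE-RUN here
from the landed `TwoVariableDescent.*` ∕ `CoeffRing.*` (this file deliberately does not import
`ErratumRoadFiveErratumThm23OfTwoVariable`, so that the v3 skeleton can import this file alone). So the v3
skeleton's `ErratumThm23SigmaLe_of` is this theorem, and registering v3 costs the planner nothing beyond the two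
stub texts. CONDITIONAL on its two displayed hypotheses (S1 OPEN; the corner a residual); closes nothing
by itself; BSD is proved for no pair.

[claim: FouquetWan2021, Thm. 4.41, status: under-review] [claim: Castella2018Erratum, Thm. 2.3, status: under-review]
[cite: JetchevSkinnerWan2017, §3.4, Lemma 3.4.1, Cor. 3.4.2 (arXiv:1512.06894 p. 14)] [cite: Castella2018Erratum, Lemma 2.1 (p. 2)]
-/

noncomputable section

open scoped Classical

open PowerSeries NumberField IsDedekindDomain Field
  Literature.NumberTheory.EllipticCurves Literature.NumberTheory.EllipticCurves.ModularForms
  Literature.NumberTheory.EllipticCurves.BigGaloisRep Literature.NumberTheory.EllipticCurves.GreenbergSelmer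
  Literature.NumberTheory.GaloisRepresentations

-- D-0017: single-problem summit, the namespace repeats the problem name by design.
set_option linter.dupNamespace false
set_option autoImplicit false

namespace Summit.BirchSwinnertonDyer.BirchSwinnertonDyer.Theorems.ErratumThm23TwoVariable.ErratumChainV3

set_option maxHeartbeats 800000 in
-- statement-sized packages over the iterated big representation (as `control_newform` ∕ `AtData…`); the proof is glue
/-- **F4♯ from the two-variable core and the anomalous corner** — the composition `ErratumThm23SigmaLe_of` of the
v3 line `erratum_chain` of crux 25505 as a theorem: `hFW` = registered stub `stub_FW21_twoVarSigmaLePinned`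
verbatim (OPEN: [FW21 4.41] + App. B + wt-`k` CGS restriction, pinned), `hC` = the `¬(dec)` corner verbatim;
everything else ((glob) from irreducibility, (unr), finite generation, EXACT two-variable control, the descent
[JSW17 Cor. 3.4.2], a cyclotomic `κ'`) is the tree's.
[cite: Castella2018Erratum, §2, proof of Thm. 2.3: (2.4) ⇒ (2.5) (p. 4)]
[cite: JetchevSkinnerWan2017, §3.4, Lemma 3.4.1 and Cor. 3.4.2 (arXiv:1512.06894 p. 14)] -/
theorem erratumThm23SigmaLe_of_twoVarCore_of_corner
    (hFW :
      ∀ {p : ℕ} [Fact p.Prime] (ι : PadicAlgCl p ≃+* ℂ) {M : ℕ} [NeZero M] {k : ℤ}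
        (g : CuspForm (CongruenceSubgroup.Gamma0 M) k) (ιg : coeffField g →+* PadicAlgCl p)
        (Δ : OrdinaryNewformDatum g p ιg)
        (K : Type) [Field K] [NumberField K] (𝔭 𝔭bar : HeightOneSpectrum (𝓞 K)) (κ : ZpExtension K p)
        (γ : absoluteGaloisGroup K) [Fact (κ.IsTopGenerator γ)] (S : Finset (HeightOneSpectrum (𝓞 K))),
        IsNewform0 g → 2 ≤ k → Even k → 3 ≤ M → ¬ p ∣ M → 3 < p →
        (∀ x : coeffField g, ι (ιg x) = (x : ℂ)) →
        ‖ιg ⟨(UpperHalfPlane.qExpansion 1 ⇑g).coeff p, coeff_mem_coeffField g p⟩‖ = 1 →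
        IsImaginaryQuadratic K → (∃ β : ℤ, (4 * M : ℤ) ∣ β ^ 2 - NumberField.discr K) →
        ((Ideal.span {(p : ℤ)}).primesOver (𝓞 K)).ncard = 2 →
        ((p : ℕ) : 𝓞 K) ∈ 𝔭.asIdeal →
        (∀ (w : InfinitePlace K) (x : 𝓞 K), x ∈ 𝔭.asIdeal ↔ ‖ι.symm (w.embedding (x : K))‖ < 1) →
        ((p : ℕ) : 𝓞 K) ∈ 𝔭bar.asIdeal → 𝔭bar ≠ 𝔭 →
        SkinnerUrban2014.IsResiduallyIrreducible Δ →
        (∃ v : HeightOneSpectrum (𝓞 ℚ), SkinnerUrban2014.IsResiduallyRamifiedAt Δ v ∧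
          ((Rat.HeightOneSpectrum.primesEquiv v : Nat.Primes) : ℕ) ∣ M ∧
          ¬ ((Rat.HeightOneSpectrum.primesEquiv v : Nat.Primes) : ℕ) ^ 2 ∣ M ∧
          ((Ideal.span {(((Rat.HeightOneSpectrum.primesEquiv v : Nat.Primes) : ℕ) : ℤ)}).primesOver (𝓞 K)).ncard ≠ 2) →
        (((Ideal.span {(2 : ℤ)}).primesOver (𝓞 K)).ncard ≠ 2 → (2 ∣ M ∧ ¬ 4 ∣ M)) →
        (∀ ℓ : ℕ, ℓ.Prime → ℓ ∣ M → ((Ideal.span {(ℓ : ℤ)}).primesOver (𝓞 K)).ncard ≠ 2 →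
          ¬ ℓ ^ 2 ∣ M ∧ (UpperHalfPlane.qExpansion 1 ⇑g).coeff ℓ = -((ℓ : ℂ) ^ (k / 2 - 1).toNat)) →
        κ.IsAnticyclotomic → (∀ w ∈ S, ((p : ℕ) : 𝓞 K) ∉ w.asIdeal) →
        (∀ w : HeightOneSpectrum (𝓞 K), ((M : ℕ) : 𝓞 K) ∈ w.asIdeal → w ∈ S) →
        ∀ (b : padicCoeffIntegers ιg →+* PadicComplexInt p),
          (∀ x, ((b x : PadicComplexInt p) : ℂ_[p]) =
            algebraMap (PadicAlgCl p) ℂ_[p] (padicCoeffIntegers.toPadicAlgCl ιg x)) →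
        ∀ (ΩK : ℂ) (Ωp : (PadicComplexInt p)ˣ) (Q : PowerSeries (PadicComplexInt p)), ΩK ≠ 0 →
          IsBDPLFunctionWtSigmaInt ι 𝔭 κ γ g S ΩK ((Ωp : PadicComplexInt p) : ℂ_[p]) Q →
        -- the complementary (cyclotomic) direction `κ'` with generator `γ'`: `Γ_K = Γ⁺ ⊕ Γ⁻ ≅ ℤ_p²` for `p` odd
        ∀ (κ' : ZpExtension K p) (γ' : absoluteGaloisGroup K) [Fact (κ'.IsTopGenerator γ')], κ'.IsCyclotomic →
        ∀ [TopologicalSpace (PowerSeries (padicCoeffIntegers ιg))]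
          [TopologicalSpace (PowerSeries (PowerSeries (padicCoeffIntegers ιg)))]
          [ContinuousSMul (PowerSeries (PowerSeries (padicCoeffIntegers ιg)))
            (BigRepModule (PowerSeries (padicCoeffIntegers ιg)) p
              (BigRepModule (padicCoeffIntegers ιg) p (Cofree Δ.ρ (padicCoeffField ιg))))],
        -- premise: `X^Σ_K(A_g)` is `Λ_K`-torsion; conclusion: a two-variable frame pinned to `Q` on `X = 0` dividing `Ch_{Λ_K}(X^Σ_K(A_g))`
        Module.IsTorsion (PowerSeries (PowerSeries (padicCoeffIntegers ιg)))
            (XBig κ' (AnticyclotomicBigGaloisRep κ (Δ.cofreeRepOver K)) 𝔭bar (↑S)) →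
        ∃ Q₂ : PowerSeries (PowerSeries (PadicComplexInt p)),
          (∃ u : (PowerSeries (PadicComplexInt p))ˣ,
              PowerSeries.constantCoeff Q₂ = (u : PowerSeries (PadicComplexInt p)) * Q) ∧
          (XBig.charIdeal κ' (AnticyclotomicBigGaloisRep κ (Δ.cofreeRepOver K)) 𝔭bar (↑S)).map
              (PowerSeries.map (PowerSeries.map b)) ≤ Ideal.span {Q₂})
    (hC :
      ∀ {p : ℕ} [Fact p.Prime] (ι : PadicAlgCl p ≃+* ℂ) {M : ℕ} [NeZero M] {k : ℤ}
        (g : CuspForm (CongruenceSubgroup.Gamma0 M) k) (ιg : coeffField g →+* PadicAlgCl p)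
        (Δ : OrdinaryNewformDatum g p ιg)
        (K : Type) [Field K] [NumberField K] (𝔭 𝔭bar : HeightOneSpectrum (𝓞 K)) (κ : ZpExtension K p)
        (γ : absoluteGaloisGroup K) [Fact (κ.IsTopGenerator γ)] (S : Finset (HeightOneSpectrum (𝓞 K))),
        IsNewform0 g → 2 ≤ k → Even k → 3 ≤ M → ¬ p ∣ M → 3 < p →
        ¬ (∀ a : Cofree Δ.ρ (padicCoeffField ιg),
            (∀ σ : LocalGroup K (Sum.inl 𝔭bar), (Δ.cofreeRepOver K) (localMap K (Sum.inl 𝔭bar) σ) a = a) →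
            (∃ j : ℕ, p ^ j • a = 0) → a = 0) →
        (∀ x : coeffField g, ι (ιg x) = (x : ℂ)) →
        ‖ιg ⟨(UpperHalfPlane.qExpansion 1 ⇑g).coeff p, coeff_mem_coeffField g p⟩‖ = 1 →
        IsImaginaryQuadratic K → (∃ β : ℤ, (4 * M : ℤ) ∣ β ^ 2 - NumberField.discr K) →
        ((Ideal.span {(p : ℤ)}).primesOver (𝓞 K)).ncard = 2 →
        ((p : ℕ) : 𝓞 K) ∈ 𝔭.asIdeal →
        (∀ (w : InfinitePlace K) (x : 𝓞 K), x ∈ 𝔭.asIdeal ↔ ‖ι.symm (w.embedding (x : K))‖ < 1) →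
        ((p : ℕ) : 𝓞 K) ∈ 𝔭bar.asIdeal → 𝔭bar ≠ 𝔭 →
        SkinnerUrban2014.IsResiduallyIrreducible Δ →
        (∃ v : HeightOneSpectrum (𝓞 ℚ), SkinnerUrban2014.IsResiduallyRamifiedAt Δ v ∧
          ((Rat.HeightOneSpectrum.primesEquiv v : Nat.Primes) : ℕ) ∣ M ∧
          ¬ ((Rat.HeightOneSpectrum.primesEquiv v : Nat.Primes) : ℕ) ^ 2 ∣ M ∧
          ((Ideal.span {(((Rat.HeightOneSpectrum.primesEquiv v : Nat.Primes) : ℕ) : ℤ)}).primesOver (𝓞 K)).ncard ≠ 2) →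
        (((Ideal.span {(2 : ℤ)}).primesOver (𝓞 K)).ncard ≠ 2 → (2 ∣ M ∧ ¬ 4 ∣ M)) →
        (∀ ℓ : ℕ, ℓ.Prime → ℓ ∣ M → ((Ideal.span {(ℓ : ℤ)}).primesOver (𝓞 K)).ncard ≠ 2 →
          ¬ ℓ ^ 2 ∣ M ∧ (UpperHalfPlane.qExpansion 1 ⇑g).coeff ℓ = -((ℓ : ℂ) ^ (k / 2 - 1).toNat)) →
        κ.IsAnticyclotomic → (∀ w ∈ S, ((p : ℕ) : 𝓞 K) ∉ w.asIdeal) →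
        (∀ w : HeightOneSpectrum (𝓞 K), ((M : ℕ) : 𝓞 K) ∈ w.asIdeal → w ∈ S) →
        ∀ (b : padicCoeffIntegers ιg →+* PadicComplexInt p),
          (∀ x, ((b x : PadicComplexInt p) : ℂ_[p]) =
            algebraMap (PadicAlgCl p) ℂ_[p] (padicCoeffIntegers.toPadicAlgCl ιg x)) →
        ∀ (ΩK : ℂ) (Ωp : (PadicComplexInt p)ˣ) (Q : PowerSeries (PadicComplexInt p)), ΩK ≠ 0 →
          IsBDPLFunctionWtSigmaInt ι 𝔭 κ γ g S ΩK ((Ωp : PadicComplexInt p) : ℂ_[p]) Q →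
        ∀ [TopologicalSpace (PowerSeries (padicCoeffIntegers ιg))]
          [ContinuousSMul (PowerSeries (padicCoeffIntegers ιg))
            (BigRepModule (padicCoeffIntegers ιg) p (Cofree Δ.ρ (padicCoeffField ιg)))],
        Module.IsTorsion (PowerSeries (padicCoeffIntegers ιg)) (XBig κ (Δ.cofreeRepOver K) 𝔭bar (↑S)) →
        (XBig.charIdeal κ (Δ.cofreeRepOver K) 𝔭bar (↑S)).map (PowerSeries.map b) ≤ Ideal.span {Q}) :
    Summit.BirchSwinnertonDyer.BirchSwinnertonDyer.Theses.ErratumRoadFive.ErratumThm23SigmaLe := by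
  intro p _ ι M _ k g ιg Δ K _ _ 𝔭 𝔭bar κ γ _ S h1 h2 h3 h4 h5 h6 h7 h8 h9 h10 h11 h12 h13 h14 h15 h16 h17 h18 h19
    h20 h21 h22 b h23 ΩK Ωp Q h24 h25 _i1 _i2 h26
  by_cases hdec : ∀ a : Cofree Δ.ρ (padicCoeffField ιg),
      (∀ σ : LocalGroup K (Sum.inl 𝔭bar), (Δ.cofreeRepOver K) (localMap K (Sum.inl 𝔭bar) σ) a = a) →
      (∃ j : ℕ, p ^ j • a = 0) → a = 0
  · -- (glob) from irreducibility (tree theorem)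
    have hglob := IrrK.noFixedTorsion_of_isResiduallyIrreducible' Δ K h6 h9 h16
    -- a cyclotomic `ℤ_p`-extension with a topological generator; any topology on `Λ_K` (the conclusion does not see it)
    obtain ⟨κ', hκ'⟩ := Literature.NumberTheory.EllipticCurves.exists_cyclotomicZpExtension_holds K p
    obtain ⟨γ', hγ'⟩ := κ'.surjective (Multiplicative.ofAdd 1)
    haveI : Fact (κ'.IsTopGenerator γ') := ⟨hγ'⟩
    letI : TopologicalSpace (PowerSeries (PowerSeries (padicCoeffIntegers ιg))) := ⊥
    haveI : DiscreteTopology (PowerSeries (PowerSeries (padicCoeffIntegers ιg))) := ⟨rfl⟩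
    -- (unr) and the one-variable finite generation, from the tree
    have hSM' : ∀ w : HeightOneSpectrum (𝓞 K), w ∉ (↑S : Set (HeightOneSpectrum (𝓞 K))) →
        ((M : ℕ) : 𝓞 K) ∉ w.asIdeal := fun w hw hM ↦ hw (Finset.mem_coe.2 (h22 w hM))
    have hunr := OrdinaryNewformDatum.cofreeRepOver_localMap_inr_apply_eq_self Δ (K := K) (↑S) hSM'
    haveI : Module.Finite (PowerSeries (padicCoeffIntegers ιg)) (XBig κ (Δ.cofreeRepOver K) 𝔭bar (↑S)) :=
      SkinnerUrban2014.moduleFinite_XBig_newform Δ (CoeffRing.finiteDimensional_padicCoeffField ιg h1) K κ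
        𝔭bar (↑S) S.finite_toSet hSM'
    haveI := ControlAt.module_finite_XBig_iterate κ κ' (Δ.cofreeRepOver K) 𝔭bar (↑S) hglob hdec hunr
    -- the EXACT control map (kernel zero, hence pseudo-null), packaged with `Exists.choose`
    have key := ControlAt.exists_controlMap κ κ' (Δ.cofreeRepOver K) 𝔭bar (↑S) hglob hdec hunr
    -- ring-theoretic clauses for the newform's coefficient ring (as in `AtData…`, p611089 §1)
    haveI := CoeffRing.finiteDimensional_padicCoeffField ιg h1
    haveI : IsPrincipalIdealRing (padicCoeffIntegers ιg) := CoeffRing.isPrincipalIdealRing ιg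
    haveI : UniqueFactorizationMonoid (PowerSeries (PowerSeries (padicCoeffIntegers ιg))) :=
      CoeffRing.uniqueFactorizationMonoid_powerSeries_powerSeries ιg
    -- two-variable torsion from the one-variable torsion premise + control (determinant trick)
    have hs := TwoVariableDescent.exists_constantCoeff_ne_zero_of_control
      (A := PowerSeries (padicCoeffIntegers ιg))
      (XBig κ' (AnticyclotomicBigGaloisRep κ (Δ.cofreeRepOver K)) 𝔭bar (↑S))
      (XBig κ (Δ.cofreeRepOver K) 𝔭bar (↑S)) h26 key.choose key.choose_spec.2.2
    have htors₂ := TwoVariableDescent.isTorsion_of_exists_constantCoeff_ne_zero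
      (A := PowerSeries (padicCoeffIntegers ιg))
      (XBig κ' (AnticyclotomicBigGaloisRep κ (Δ.cofreeRepOver K)) 𝔭bar (↑S)) hs
    -- the two-variable core (S1), for this cyclotomic `κ'`
    obtain ⟨Q₂, ⟨u, hu⟩, hle⟩ := hFW ι g ιg Δ K 𝔭 𝔭bar κ γ S h1 h2 h3 h4 h5 h6 h7 h8 h9 h10 h11 h12 h13
      h14 h15 h16 h17 h18 h19 h20 h21 h22 b h23 ΩK Ωp Q h24 h25 κ' γ' hκ' htors₂
    -- descent of the characteristic ideal along `T_c ↦ 0` (JSW Cor. 3.4.2, kernel form), read in `𝓞_{ℂ_p}`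
    have hdesc := TwoVariableDescent.charIdeal_le_map_constantCoeff_of_control
      (A := PowerSeries (padicCoeffIntegers ιg))
      (XBig κ' (AnticyclotomicBigGaloisRep κ (Δ.cofreeRepOver K)) 𝔭bar (↑S))
      (XBig κ (Δ.cofreeRepOver K) 𝔭bar (↑S)) h26 key.choose key.choose_spec.1 key.choose_spec.2.2
    refine (Ideal.map_mono hdesc).trans ?_
    rw [TwoVariableDescent.map_map_constantCoeff_eq b]
    exact TwoVariableDescent.map_constantCoeff_le_span_of_le_span_of_eq_unit_mul hle hu
  · exact hC ι g ιg Δ K 𝔭 𝔭bar κ γ S h1 h2 h3 h4 h5 h6 hdec h7 h8 h9 h10 h11 h12 h13 h14 h15 h16 h17 h18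
      h19 h20 h21 h22 b h23 ΩK Ωp Q h24 h25 h26

end Summit.BirchSwinnertonDyer.BirchSwinnertonDyer.Theorems.ErratumThm23TwoVariable.ErratumChainV3

end
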